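import Summits.BirchSwinnertonDyer.BirchSwinnertonDyer.Theorems.ManinLocalTwoThreeCThreeResidualOfFacts
import Summits.BirchSwinnertonDyer.BirchSwinnertonDyer.Theorems.ManinLocalTwoThreeDescentTwo
import Summits.BirchSwinnertonDyer.BirchSwinnertonDyer.Theorems.ManinLocalTwoThreeNotTrivialEisensteinAtTwo
import Summits.BirchSwinnertonDyer.BirchSwinnertonDyer.Theorems.ManinLocalTwoThreeKatoShiftTwoReal
import Summits.BirchSwinnertonDyer.BirchSwinnertonDyer.Theorems.ManinLocalTwoThreeTwistOrbitMinimalResidualSynthesis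
import Literature.NumberTheory.EllipticCurves.KatoAdditiveTwistedValueNeronIntegralityTwoReal
import HarnessLib

/-!
# C2 `ManinOddAtFour` BY NAME from FOUR NAMED inputs and the reducible residual (lead integration, v8: E-es-40₂ is proved)

Summit `BirchSwinnertonDyer`, route `ManinLocalTwoThree` (cell bsd-f2-manin), deciding crux C2 `ManinOddAtFour`
(stmt-BirchSwinnertonDyer-22967), line `kato_shift_two` v8 (lead p1).  The §25 chain of the cell is in the tree end-to-end
(leaves p605979, E-es-38 p605636, LEMMA C p604131, E-es-42 p606740, vertices p606516/p606925, E-es-37 p607037/p607636/p608085/p608494,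
closers p607097/p607316/p608031/p608851) and the Chebotarev leaf E-es-40₂ is now a THEOREM (`Theorems.stub_notTrivialEisensteinAtTwo`,
p610460).  This file records the state of the crux KERNEL-EXACTLY with every remaining input a NAMED tree `Prop`:

* `multiShiftClassGenerationTwo_of_threeFacts` — E-es-22 `MultiShiftClassGenerationTwo` from THREE named Props: the Literature
  facts F-es-27′ `sl2ZModOddPrime_existsUnique_extension_of_stable_character` (`H²(SL₂(𝔽_t);𝔽₂) = 0`, `t` odd) and E-es-43
  `gamma0Away_character_extension_of_shiftInvariant` (abelianised Serre amalgam), and the Chebotarev leaf E-es-40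
  `NotTrivialEisensteinOfIrreducibleTwo` at odd `t ∥ N` (`@[conjecture]` def) — E-es-40₂ being discharged by the lead's theorem;
* `katoShiftTwistManinTwo_of_fourFacts` — E-es-21 from F♯ `kato_neron_isIntegral_twistedSymbolSum_of_additive_two_real` and the three;
* **`maninOddAtFour_of_fourFacts`** — the ROUTE DECL `Theses.ManinLocalTwoThree.ManinOddAtFour` from the four named Props and the
  ORBIT-MINIMAL `W[2]`-REDUCIBLE RESIDUAL (stub `stub_minimalReducibleResidual`, verbatim), via
  `katoShiftTwistManinTwo_of_realKatoFact_of_generation` / `katoManinOddTwo_of_realKatoFact_of_generation` (p599224) and p2's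
  orbit-minimal synthesis `maninLocalTwoThree_maninOddAtFour_of_orbitMinimalKatoShift_of_orbitMinimalResiduals`;
* `maninOddAtFour_of_fourFacts_of_reducible` — the same with the unrestricted reducible residual `ManinOddOfReducibleAtFour`.

CONDITIONAL results (the gate's `proof.conditional`): C2 is reduced to {Kato F♯, F-es-27′, E-es-43, E-es-40 (odd `t ∥ N`)} —
printed/standard statements, none open — plus the reducible residual Rb, which IS open mathematics (Manin's conjecture at `2` for
curves with a rational `2`-isogeny, additive at `2`).  No new definitions.  Nothing about BSD is proved here; Manin's conjecture is
not proved here.  References: cell memos HOME/MEMO-es.md §21–§25, HOME/MEMO-an.md §54; K. Kato, Astérisque 295 (2004) Thm. 9.7/12.5;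
J.-P. Serre, *Trees* II.1.4; A. Wiles, Ann. of Math. 141 (1995) Lemma 2.5; J. Tate, GCFT §2.4.
-/

set_option autoImplicit false
set_option linter.dupNamespace false

noncomputable section

open scoped Classical MatrixGroups ModularForm
open CongruenceSubgroup WeierstrassCurve Literature.NumberTheory.EllipticCurves
  Literature.NumberTheory.EllipticCurves.ModularForms
  Literature.NumberTheory.EllipticCurves.ModularForms.HidaCohomology
  Literature.GroupTheory.SpecificGroups
  Summit.BirchSwinnertonDyer.Rank1Residual.ManinAdditive

namespace Summit.BirchSwinnertonDyer.BirchSwinnertonDyer.Theorems.ManinLocalTwoThree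

/-- **E-es-22 `MultiShiftClassGenerationTwo` from THREE named Props** (F-es-27′, E-es-43, E-es-40 at odd `t`): p3's
`multiShiftClassGenerationTwo_of_descent₂_and_facts` with the descent discharged by p2's `shiftInvariantDescentTwo_two_of_two_le`
(E-es-37) and E-es-40₂ discharged by the lead's `Theorems.stub_notTrivialEisensteinAtTwo`. [cite: Shimura1971, §8.3 (8.3.2)] -/
theorem multiShiftClassGenerationTwo_of_threeFacts
    (h27 : sl2ZModOddPrime_existsUnique_extension_of_stable_character)
    (h43 : gamma0Away_character_extension_of_shiftInvariant)
    (hNT : NotTrivialEisensteinOfIrreducibleTwo) :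
    MultiShiftClassGenerationTwo :=
  multiShiftClassGenerationTwo_of_descent₂_and_facts shiftInvariantDescentTwo_two_of_two_le h27 h43
    Summit.BirchSwinnertonDyer.BirchSwinnertonDyer.Theorems.stub_notTrivialEisensteinAtTwo hNT

/-- **E-es-21 `KatoShiftTwistManinTwo` from F♯ and the three named Props.** [cite: Kato2004Asterisque, Thm. 9.7 (p. 189)] -/
theorem katoShiftTwistManinTwo_of_fourFacts
    (hF : kato_neron_isIntegral_twistedSymbolSum_of_additive_two_real)
    (h27 : sl2ZModOddPrime_existsUnique_extension_of_stable_character)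
    (h43 : gamma0Away_character_extension_of_shiftInvariant)
    (hNT : NotTrivialEisensteinOfIrreducibleTwo) :
    KatoShiftTwistManinTwo :=
  katoShiftTwistManinTwo_of_realKatoFact_of_generation hF (multiShiftClassGenerationTwo_of_threeFacts h27 h43 hNT)

/-- **C2 `ManinOddAtFour` BY NAME from four named inputs and the ORBIT-MINIMAL reducible residual** (stub
`stub_minimalReducibleResidual` of `kato_shift_two` v8 verbatim): F♯ + E-es-22 give E-es-21 and the archimedean residual on the
irreducible locus (`katoShiftTwistManinTwo_of_realKatoFact_of_generation`, `katoManinOddTwo_of_realKatoFact_of_generation`); p2's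
orbit-minimal synthesis closes the route decl given Manin-at-2 on the twist-orbit-minimal `W[2]`-reducible classes.  CONDITIONAL result;
the reducible residual is open. [cite: Kato2004Asterisque, Thm. 9.7 (p. 189)] -/
theorem maninOddAtFour_of_fourFacts
    (hF : kato_neron_isIntegral_twistedSymbolSum_of_additive_two_real)
    (h27 : sl2ZModOddPrime_existsUnique_extension_of_stable_character)
    (h43 : gamma0Away_character_extension_of_shiftInvariant)
    (hNT : NotTrivialEisensteinOfIrreducibleTwo)
    (hRb : ∀ (W : WeierstrassCurve ℚ) [W.IsElliptic] [W.IsGloballyMinimal] {N : ℕ} [NeZero N]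
      (D : ModularParametrizationData W N),
      (∀ z ∈ D.L.lattice, ∃ w ∈ periodLattice D.f, z = D.c * w) → 2 ^ 2 ∣ N →
      ¬ (∃ (W' : WeierstrassCurve ℚ) (d : ℤ), W'.IsElliptic ∧ W'.IsGloballyMinimal ∧
        (d = -1 ∨ d = 2 ∨ d = -2) ∧ IsIsogenous W (W'.quadraticTwist (d : ℚ)) ∧
        ¬ 2 ^ 2 ∣ W'.conductorNorm ℤ) →
      ¬ (∃ (W' : WeierstrassCurve ℚ) (q : ℕ), W'.IsElliptic ∧ W'.IsGloballyMinimal ∧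
        q.Prime ∧ q ≠ 2 ∧ q ^ 2 ∣ N ∧
        IsIsogenous W (W'.quadraticTwist (((-1 : ℤ) ^ (q / 2) * q : ℤ) : ℚ)) ∧
        ¬ q ^ 2 ∣ W'.conductorNorm ℤ) →
      ¬ (∃ (A : WeierstrassCurve ℚ), A.IsElliptic ∧ A.IsGloballyMinimal ∧ 2 ^ 4 ∣ N ∧
        2 ^ 2 ∣ A.conductorNorm ℤ ∧ A.conductorNorm ℤ ∣ N ∧ A.conductorNorm ℤ < N ∧
        IsIsogenous W (A.quadraticTwist ((-1 : ℤ) : ℚ))) →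
      ¬ (∃ (A : WeierstrassCurve ℚ) (_ : A.IsElliptic) (_ : A.IsGloballyMinimal) (N' : ℕ) (_ : NeZero N')
        (D' : ModularParametrizationData A N') (d : ℤ) (C : WeierstrassCurve ℚ) (u : VariableChange ℚ),
        C.IsElliptic ∧ C.IsGloballyMinimal ∧
        (∀ z ∈ D'.L.lattice, ∃ w ∈ periodLattice D'.f, z = D'.c * w) ∧ (d = 2 ∨ d = -2) ∧ 2 ^ 6 ∣ N ∧
        2 ^ 2 ∣ A.conductorNorm ℤ ∧ A.conductorNorm ℤ ∣ N ∧
        IsIsogenous W (A.quadraticTwist (d : ℚ)) ∧ u • A.quadraticTwist (d : ℚ) = C ∧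
        C.Δ = (d : ℚ) ^ 6 * A.Δ ∧
        (A.conductorNorm ℤ < N ∨ A.minimalDiscriminantInt.natAbs < W.minimalDiscriminantInt.natAbs)) →
      ¬ (∃ (A : WeierstrassCurve ℚ) (_ : A.IsElliptic) (_ : A.IsGloballyMinimal)
        (D' : ModularParametrizationData A N) (q : ℕ) (C : WeierstrassCurve ℚ) (u : VariableChange ℚ),
        C.IsElliptic ∧ C.IsGloballyMinimal ∧
        (∀ z ∈ D'.L.lattice, ∃ w ∈ periodLattice D'.f, z = D'.c * w) ∧ q.Prime ∧ q ≠ 2 ∧ q ^ 2 ∣ N ∧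
        IsIsogenous C W ∧ u • A.quadraticTwist (((-1 : ℤ) ^ (q / 2) * q : ℤ) : ℚ) = C ∧
        C.Δ = ((((-1 : ℤ) ^ (q / 2) * q : ℤ)) : ℚ) ^ 6 * A.Δ ∧
        A.minimalDiscriminantInt.natAbs < W.minimalDiscriminantInt.natAbs) →
      ¬ W.HasIrreducibleModPGaloisRep 2 → ¬ (2 : ℤ) ∣ D.c) :
    Summit.BirchSwinnertonDyer.BirchSwinnertonDyer.Theses.ManinLocalTwoThree.ManinOddAtFour :=
  have hG : MultiShiftClassGenerationTwo := multiShiftClassGenerationTwo_of_threeFacts h27 h43 hNT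
  Summit.BirchSwinnertonDyer.BirchSwinnertonDyer.Theorems.maninLocalTwoThree_maninOddAtFour_of_orbitMinimalKatoShift_of_orbitMinimalResiduals
    (fun W _ _ _ _ D hopt h4 _ _ _ _ _ hirr =>
      katoShiftTwistManinTwo_of_realKatoFact_of_generation hF hG W D hopt h4 hirr)
    (fun W _ _ _ _ D hopt h4 _ _ _ _ _ hirr _ _ =>
      katoManinOddTwo_of_realKatoFact_of_generation hF hG W D hopt h4 hirr)
    hRb

/-- **C2 `ManinOddAtFour` BY NAME from four named inputs and the UNRESTRICTED reducible residual `ManinOddOfReducibleAtFour`.**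
CONDITIONAL result. [cite: Kato2004Asterisque, Thm. 9.7 (p. 189)] -/
theorem maninOddAtFour_of_fourFacts_of_reducible
    (hF : kato_neron_isIntegral_twistedSymbolSum_of_additive_two_real)
    (h27 : sl2ZModOddPrime_existsUnique_extension_of_stable_character)
    (h43 : gamma0Away_character_extension_of_shiftInvariant)
    (hNT : NotTrivialEisensteinOfIrreducibleTwo) (hRb : ManinOddOfReducibleAtFour) :
    Summit.BirchSwinnertonDyer.BirchSwinnertonDyer.Theses.ManinLocalTwoThree.ManinOddAtFour :=
  maninOddAtFour_of_realKatoFact_of_generation_of_reducible hF (multiShiftClassGenerationTwo_of_threeFacts h27 h43 hNT) hRb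

end Summit.BirchSwinnertonDyer.BirchSwinnertonDyer.Theorems.ManinLocalTwoThree

end
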